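import Mathlib
import Literature.Analysis.Complex.DbarInequalityLeadingTerm
import HarnessLib

/-!
# The holomorphic leading term of a `J`-holomorphic curve in a smooth chart

Chart version of Wendl 2020, App. B, Cor. B.21 / Rem. B.22 for smooth `J`-holomorphic curves
(companion of `Literature/Geometry/Symplectic/JHolomorphicLeadingTerm.lean`, where the chart is
linear). Let `J` be a `C¹` almost complex structure on an open `U ⊆ F`,
`u : B(z₀,R) → U` smooth with `∂_y u = J(u) ∂ₓ u` and not locally constant at `z₀`, and let `Θ` be a
smooth chart of `F` about `p = u(z₀)` with values in `ℂⁿ`, `Θ(p) = 0`, with `C¹` inverse and with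
differential at `p` complex-linear from `(T_pF, J(p))` to `(ℂⁿ, i)`:

  `DΘ(p) ∘ J(p) = i • DΘ(p)`.

Then (`jHolomorphic_leadingTerm_chart`) `Θ(u(z₀ + z)) = z^k • b + R(z)` with `k ≥ 1`,
`b ∈ ℂⁿ ∖ {0}`, `‖R(z)‖ ≤ C|z|^{k+1}` and `‖DR(z)‖ ≤ C|z|^k` near `0`. This is the form in which
the leading term enters the local representation formula (Wendl 2020, Thm B.23, §B.2.3: the
chart `Θ` there is nonlinear, adapted to `J` along an axis), via the vector-valued theorem
`Literature.Analysis.Complex.exists_leadingTerm_bounds` for `‖Dh(1) + iDh(i)‖ ≤ M‖h‖`: with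
`h = Θ ∘ u(z₀ + ·)`, `Dh(1) + iDh(i) = [DΘ(u) + i DΘ(u) J(u)] ∂ₓu`, and the operator field
`x ↦ DΘ(x) + i DΘ(x) J(x)` is `C¹` and vanishes at `p`, hence `O(‖x - p‖) = O(‖h‖)`.

Everything is proved; no named facts.

## References

* C. Wendl, *Lectures on Contact 3-Manifolds, Holomorphic Curves and Intersection Theory*,
  Cambridge Tracts in Math. 220 (2020), App. B, Cor. B.21, Rem. B.22, Thm B.23, §B.2.3. [Wendl2020]
* D. McDuff, D. Salamon, *J-holomorphic curves and symplectic topology*, 2nd ed. (2012), §2.3.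
  [McDuffSalamon2012]
-/

noncomputable section

open scoped ContDiff Topology
open Set Filter Metric Function Complex

namespace Literature.Geometry.Symplectic

open Literature.Analysis.Complex

/-- **Holomorphic leading term of a `J`-holomorphic curve in a smooth chart with complex-linear
differential at the base point.** See the module docstring.
[cite: Wendl2020, App. B, Cor. B.21, Rem. B.22 and §B.2.3] -/
theorem jHolomorphic_leadingTerm_chart {F : Type*} [NormedAddCommGroup F] [NormedSpace ℝ F]
    [CompleteSpace F] {n : ℕ}
    {J : F → F →L[ℝ] F} {U : Set F} (hU : IsOpen U) (hJ : ContDiffOn ℝ 1 J U)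
    {u : ℂ → F} {z₀ : ℂ} {R : ℝ} (hR : 0 < R) (hu : ContDiffOn ℝ ∞ u (ball z₀ R))
    (huU : MapsTo u (ball z₀ R) U)
    (hhol : ∀ z ∈ ball z₀ R, fderiv ℝ u z I = J (u z) (fderiv ℝ u z 1))
    (hnc : ∃ᶠ z in 𝓝 z₀, u z ≠ u z₀)
    (Θ : OpenPartialHomeomorph F (EuclideanSpace ℂ (Fin n))) (hpΘ : u z₀ ∈ Θ.source)
    (hΘ0 : Θ (u z₀) = 0) (hΘ : ContDiffOn ℝ ∞ Θ Θ.source) (hΘsymm : ContDiffOn ℝ 1 Θ.symm Θ.target)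
    (hlin : ∀ v, fderiv ℝ Θ (u z₀) (J (u z₀) v) = I • fderiv ℝ Θ (u z₀) v) :
    ∃ (k : ℕ) (b : EuclideanSpace ℂ (Fin n)) (C ρ : ℝ), 0 < k ∧ b ≠ 0 ∧ 0 < ρ ∧ ρ ≤ R ∧
      MapsTo u (ball z₀ ρ) Θ.source ∧
      (∀ z ∈ ball (0 : ℂ) ρ, ‖Θ (u (z₀ + z)) - z ^ k • b‖ ≤ C * ‖z‖ ^ (k + 1)) ∧
      (∀ z ∈ ball (0 : ℂ) ρ,
        ‖fderiv ℝ (fun z => Θ (u (z₀ + z)) - z ^ k • b) z‖ ≤ C * ‖z‖ ^ k) := by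
  set p : F := u z₀ with hp
  have hpU : p ∈ U := huU (mem_ball_self hR)
  -- Step 0: a radius on which `u` stays in `Θ.source ∩ U`
  have hSU : Θ.source ∩ U ∈ 𝓝 p := inter_mem (Θ.open_source.mem_nhds hpΘ) (hU.mem_nhds hpU)
  have hucont : ContinuousAt u z₀ := hu.continuousOn.continuousAt (ball_mem_nhds z₀ hR)
  obtain ⟨R'₀, hR'₀, hR'₀sub⟩ : ∃ R' > 0, ball z₀ R' ⊆ ball z₀ R ∩ u ⁻¹' (Θ.source ∩ U) := by
    have h1 : ball z₀ R ∩ u ⁻¹' (Θ.source ∩ U) ∈ 𝓝 z₀ :=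
      inter_mem (ball_mem_nhds z₀ hR) (hucont.preimage_mem_nhds hSU)
    exact Metric.mem_nhds_iff.1 h1
  set R' : ℝ := min R'₀ R with hR'_def
  have hR' : 0 < R' := lt_min hR'₀ hR
  have hR'le : R' ≤ R := min_le_right _ _
  have hR'sub : ball z₀ R' ⊆ ball z₀ R ∩ u ⁻¹' (Θ.source ∩ U) :=
    (ball_subset_ball (min_le_left _ _)).trans hR'₀sub
  have hR'R : ball z₀ R' ⊆ ball z₀ R := fun z hz => (hR'sub hz).1
  have husrc : ∀ z ∈ ball z₀ R', u z ∈ Θ.source := fun z hz => (hR'sub hz).2.1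
  have huU' : ∀ z ∈ ball z₀ R', u z ∈ U := fun z hz => (hR'sub hz).2.2
  -- the map in the chart
  set h : ℂ → EuclideanSpace ℂ (Fin n) := fun z => Θ (u (z₀ + z)) with hh_def
  have hball : ∀ {r : ℝ} {z : ℂ}, z ∈ ball (0 : ℂ) r → z₀ + z ∈ ball z₀ r := by
    intro r z hz; simpa [mem_ball, dist_eq_norm] using hz
  have hut : ContDiffOn ℝ ∞ (fun z : ℂ => u (z₀ + z)) (ball (0 : ℂ) R') :=
    (hu.mono hR'R).comp (contDiff_const.add contDiff_id).contDiffOn fun z hz => hball hz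
  have hh : ContDiffOn ℝ ∞ h (ball (0 : ℂ) R') :=
    hΘ.comp hut fun z hz => husrc _ (hball hz)
  -- the derivative of `h`
  have hfd : ∀ z ∈ ball (0 : ℂ) R', ∀ w : ℂ,
      fderiv ℝ h z w = fderiv ℝ Θ (u (z₀ + z)) (fderiv ℝ u (z₀ + z) w) := by
    intro z hz w
    have hzs : u (z₀ + z) ∈ Θ.source := husrc _ (hball hz)
    have hdΘ : DifferentiableAt ℝ Θ (u (z₀ + z)) :=
      (hΘ.differentiableOn (by simp)).differentiableAt (Θ.open_source.mem_nhds hzs)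
    have hdu : DifferentiableAt ℝ (fun z : ℂ => u (z₀ + z)) z :=
      (hut.differentiableOn (by simp)).differentiableAt (isOpen_ball.mem_nhds hz)
    have : h = Θ ∘ fun z => u (z₀ + z) := rfl
    rw [this, fderiv_comp z hdΘ hdu, ContinuousLinearMap.comp_apply, fderiv_comp_add_left]
  -- Step 1: the operator field `M(x) = DΘ(x) + i DΘ(x) J(x)` is `C¹` near `p` and vanishes at `p`
  set Mf : F → (F →L[ℝ] EuclideanSpace ℂ (Fin n)) :=
    fun x => fderiv ℝ Θ x + I • (fderiv ℝ Θ x).comp (J x) with hMf_def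
  have hMp : Mf p = 0 := by
    ext1 v
    show fderiv ℝ Θ p v + I • fderiv ℝ Θ p (J p v) = 0
    rw [hlin v, smul_smul, I_mul_I, neg_one_smul, add_neg_cancel]
  have hMdiff : ContDiffOn ℝ 1 Mf (Θ.source ∩ U) := by
    have hD : ContDiffOn ℝ 1 (fderiv ℝ Θ) (Θ.source ∩ U) :=
      (hΘ.fderiv_of_isOpen (m := 1) Θ.open_source (by norm_cast)).mono inter_subset_left
    have hJ' : ContDiffOn ℝ 1 J (Θ.source ∩ U) := hJ.mono inter_subset_right
    exact hD.add ((hD.clm_comp hJ').const_smul I)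
  obtain ⟨K, t, ht, hK⟩ := (hMdiff.contDiffAt hSU).exists_lipschitzOnWith
  obtain ⟨δ₁, hδ₁, hδ₁t⟩ := Metric.mem_nhds_iff.1 ht
  have hMbound : ∀ x ∈ ball p δ₁, ‖Mf x‖ ≤ K * ‖x - p‖ := by
    intro x hx
    have := hK.dist_le_mul x (hδ₁t hx) p (hδ₁t (mem_ball_self hδ₁))
    rwa [dist_eq_norm, dist_eq_norm, hMp, sub_zero] at this
  -- Step 2: `Θ.symm` is Lipschitz near `0`
  have h0t : (0 : EuclideanSpace ℂ (Fin n)) ∈ Θ.target := by rw [← hΘ0]; exact Θ.map_source hpΘ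
  obtain ⟨K', t', ht', hK'⟩ :=
    (hΘsymm.contDiffAt (Θ.open_target.mem_nhds h0t)).exists_lipschitzOnWith
  obtain ⟨δ₂, hδ₂, hδ₂t⟩ := Metric.mem_nhds_iff.1 ht'
  -- Step 3: a bound for `∂ₓu` near `z₀`
  have hcont : ContinuousOn (fderiv ℝ u) (ball z₀ R) :=
    hu.continuousOn_fderiv_of_isOpen isOpen_ball (by norm_cast)
  obtain ⟨δ₃, hδ₃, hδ₃b⟩ := Metric.continuousAt_iff.1
    (hcont.continuousAt (ball_mem_nhds z₀ hR)) 1 one_pos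
  set B : ℝ := ‖fderiv ℝ u z₀‖ + 1 with hB
  -- Step 4: continuity: `u` near `p`, `h` near `0`
  obtain ⟨δ₄, hδ₄, hδ₄b⟩ := Metric.continuousAt_iff.1 hucont δ₁ hδ₁
  have hhcont : ContinuousAt h 0 := (hh.continuousOn.continuousAt (ball_mem_nhds 0 hR'))
  have hh0 : h 0 = 0 := by simp [hh_def, ← hp, hΘ0]
  obtain ⟨δ₅, hδ₅, hδ₅b⟩ := Metric.continuousAt_iff.1 hhcont δ₂ hδ₂
  -- the radius
  set ρ : ℝ := min R' (min (min δ₃ δ₄) δ₅) with hρ_def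
  have hρ : 0 < ρ := lt_min hR' (lt_min (lt_min hδ₃ hδ₄) hδ₅)
  have hρR' : ρ ≤ R' := min_le_left _ _
  have hρ₃ : ρ ≤ δ₃ := (min_le_right _ _).trans ((min_le_left _ _).trans (min_le_left _ _))
  have hρ₄ : ρ ≤ δ₄ := (min_le_right _ _).trans ((min_le_left _ _).trans (min_le_right _ _))
  have hρ₅ : ρ ≤ δ₅ := (min_le_right _ _).trans (min_le_right _ _)
  -- Step 5: the differential inequality on `B(0,ρ)`
  set M : ℝ := K * (K' * 1) * B with hM_def
  have hM : ∀ z ∈ ball (0 : ℂ) ρ, ‖fderiv ℝ h z 1 + I • fderiv ℝ h z I‖ ≤ K * K' * B * ‖h z‖ := by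
    intro z hz
    have hz' : ‖z‖ < ρ := by simpa using hz
    have hzR' : z ∈ ball (0 : ℂ) R' := ball_subset_ball hρR' hz
    set z' : ℂ := z₀ + z with hz'def
    have hdz : dist z' z₀ < ρ := by simpa [hz'def, dist_eq_norm] using hz'
    set x : F := u z' with hx
    set v : F := fderiv ℝ u z' 1 with hv
    -- the defect is `Mf(x) v`
    have hdef : fderiv ℝ h z 1 + I • fderiv ℝ h z I = Mf x v := by
      rw [hfd z hzR', hfd z hzR', hhol z' (hR'R (hball hzR'))]
      simp [hMf_def, hx, hv, hz'def]
    -- the bounds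
    have hxball : x ∈ ball p δ₁ := hδ₄b (hdz.trans_le hρ₄)
    have hvB : ‖v‖ ≤ B := by
      have h1 : dist (fderiv ℝ u z') (fderiv ℝ u z₀) < 1 := hδ₃b (hdz.trans_le hρ₃)
      rw [dist_eq_norm] at h1
      calc ‖v‖ ≤ ‖fderiv ℝ u z'‖ * ‖(1 : ℂ)‖ := (fderiv ℝ u z').le_opNorm 1
        _ = ‖fderiv ℝ u z'‖ := by simp
        _ = ‖(fderiv ℝ u z' - fderiv ℝ u z₀) + fderiv ℝ u z₀‖ := by rw [sub_add_cancel]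
        _ ≤ ‖fderiv ℝ u z' - fderiv ℝ u z₀‖ + ‖fderiv ℝ u z₀‖ := norm_add_le _ _
        _ ≤ B := by rw [hB]; linarith
    have hxp : ‖x - p‖ ≤ K' * ‖h z‖ := by
      have hhz : h z ∈ ball (0 : EuclideanSpace ℂ (Fin n)) δ₂ := by
        have := hδ₅b (show dist z 0 < δ₅ by simpa using hz'.trans_le hρ₅)
        rwa [hh0] at this
      have h1 : Θ.symm (h z) = x := by
        simp only [hh_def, hx, hz'def]; exact Θ.left_inv (husrc _ (hball hzR'))
      have h2 : Θ.symm 0 = p := by rw [← hΘ0]; exact Θ.left_inv hpΘ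
      have := hK'.dist_le_mul (h z) (hδ₂t hhz) 0 (hδ₂t (mem_ball_self hδ₂))
      rw [h1, h2, dist_eq_norm, dist_eq_norm, sub_zero] at this
      exact this
    rw [hdef]
    calc ‖Mf x v‖ ≤ ‖Mf x‖ * ‖v‖ := (Mf x).le_opNorm v
      _ ≤ K * ‖x - p‖ * B := by
          gcongr
          exact hMbound x hxball
      _ ≤ K * (K' * ‖h z‖) * B := by gcongr
      _ = K * K' * B * ‖h z‖ := by ring
  -- Step 6: nontriviality of `h`
  have hne : ∃ z ∈ ball (0 : ℂ) ρ, h z ≠ 0 := by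
    obtain ⟨z, hzne, hzb⟩ := (hnc.and_eventually (ball_mem_nhds z₀ hρ)).exists
    have hzb' : z - z₀ ∈ ball (0 : ℂ) ρ := by simpa [mem_ball, dist_eq_norm] using hzb
    refine ⟨z - z₀, hzb', ?_⟩
    have hzs : u z ∈ Θ.source := husrc z (ball_subset_ball hρR' hzb)
    have : h (z - z₀) = Θ (u z) := by simp [hh_def]
    rw [this, ← hΘ0]
    exact fun heq => hzne (Θ.injOn hzs hpΘ heq)
  obtain ⟨k, b, C, ρ', hk, hb, hρ', hρ'ρ, hb1, hb2⟩ :=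
    exists_leadingTerm_bounds hρ (hh.mono (ball_subset_ball hρR')) hM hh0 hne
  refine ⟨k, b, C, ρ', hk, hb, hρ', hρ'ρ.trans (hρR'.trans hR'le), fun z hz => ?_, hb1, hb2⟩
  exact husrc z (ball_subset_ball (hρ'ρ.trans hρR') hz)

end Literature.Geometry.Symplectic

end
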